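import Summits.QuantumFields.BalabanUV.T4Continuum.Support.NE7WhitneyLiftFlat
import Summits.QuantumFields.BalabanUV.T4Continuum.Support.NE3TangentFlatPush
import HarnessLib

/-!
# NE7WhitneyLiftAverage — THE ONE-STEP FLAT LINEARISED AVERAGE OF THE WHITNEY-TYPE LIFT: the straight part is the BINOMIAL SMOOTHING STENCIL
# `linQ_M (Wφ) (M•y) κ = interpCore univ (φ(·,κ)) y (const (M−1)∕(2M))`, the full push-forward is that stencil plus the coarse gauge direction of the lift's frames, and
# GAUGE DIRECTIONS ARE REPRODUCED EXACTLY: `cpush_1 (W (gaugeDir 1 ν)) = gaugeDir 1 ν`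
# (lineage `b2b-balaban-t4-ne7b-p1`, gen 162; route (H′) of `t4/b2b-balaban-t4-ne7b-p1/g162/records/SCOPING-LEVELMASSES.md` §3, the defect `cpush∘W − id`)

Cell `pub-balaban`, rung (B)+1 sub-cell t4, lineage `b2b-balaban-t4-ne7b-p1` (row NE7b OWNER + CRUX PROVER; junction service for row NE7 on ROAD-G116 §6 (G3) ∕ ROAD-G117 §4 (S1)),
generation 162; sequel of ✓ `NE7WhitneyLiftFlat` (W1a: sharp mass, exact gauge and curl commutation of `W φ (z,κ) := (M:ℝ)⁻¹ • interp M (univ∖{κ}) (φ(·,κ)) z`, written out).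
WHAT ([folklore]; 0 def, 0 sorry; every `d`):
§1 `interpCore_const_weights` (the core with constant weights `c` is the binomial stencil `Σ_{T⊆S} c^{|T|}(1−c)^{|S|−|T|} • G(z+𝟙_T)`), `sum_range_indicator_near` ∕ `_far` (the longitudinal counts);
§2 **`linQ_whitneyLift`** (`M ≥ 1`): `linQ M (Wφ) (M•y) κ = interpCore univ (φ(·,κ)) y (fun _ ↦ (M−1)∕(2M))` — the straight-line block average of the lift is the `d`-dimensional BINOMIAL
   SMOOTHING of the datum, symmetric in all directions (the κ-lines starting in block `y` read block `y` `(M+1)M∕2` times and block `y + e_κ` `(M−1)M∕2` times; transversally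
   ✓ `NE7InterpolationLiftFlat.sum_boxVec_mul_interpCore`; then ✓ `SmoothRefineInterp.interpCore_insert`);
§3 **`cpush_flatCfg_whitneyLift`**: `cpush M 1 (Wφ) y κ = (F̂(Wφ)(M•y) − F̂(Wφ)(M•y + M•e_κ)) + interpCore univ (φ(·,κ)) y (const)` (✓ `NE3TangentFlatPush.cpush_flatCfg`), i.e. the full linearised
   average of the lift = the frames' coarse gauge direction + the binomial stencil;
§4 **`cpush_flatCfg_whitneyLift_gaugeDir`** (`M ≥ 1`): `cpush M 1 (W (gaugeDir 1 ν)) = gaugeDir 1 ν` — THE LIFT IS AN EXACT RIGHT INVERSE ON THE GAUGE SECTOR (W1a's gauge commutation +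
   ✓ `cpush_flatCfg_gaugeDir` + the nodal interpolant reproduces the nodes, `interp_smul_site`); hence the defect `cpush∘W − id` ANNIHILATES GAUGE DIRECTIONS (`whitneyDefect_gaugeDir`);
§5 `interpCore_const_weights_sub_self`: the stencil defect `(S−1)φ` is a combination of the corner DIFFERENCES `φ(y+𝟙_T) − φ(y)` with the binomial weights (no zero-order term).
WHAT IS NOT HERE: the `ℓ²` letters of the two defect pieces against the coarse gradient (the frame piece through translation covariance `F̂(W φ)(M•(y+v)) = F̂(W(φ(·+v)))(M•y)`), the curved transport.
HONEST FRAMING (page 1): flat lattice kinematics of OUR lift; nothing of Bałaban's asserted ([Balaban1985Averaging] (42), (47)–(48), (110)–(125) context only); NOT (G3), NOT (G), NOT NE7∕NE3 as spine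
nodes; row NE7b NOT PRINTED ∕ NOT PROVED; spine 0∕9; finite T⁴ rung (B)+1 — NOT infinite volume, NOT mass gap, NOT BetaPertH, NOT Clay.
-/

set_option autoImplicit false

open scoped BigOperators Matrix Matrix.Norms.L2Operator
open Finset

namespace Summit.QuantumFields.BalabanUV.T4Continuum.NE7WhitneyLiftAverage

open Literature.MathematicalPhysics.QuantumFieldTheory.Balaban1983to89
open B7Prop1Explicit B7Prop2Explicit
open T4AveragingDeficitWall (IsSkewDir dirSq Ad)
open T4AveragingDeficitWallBoundary (periodBox)
open AveragingDeficitMultiLevelPrep (cpush)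
open B7Prop3Flat (Fhat linQ)
open B7Prop4Flat (linQ_eq_sum)
open BlockAveragePushDirGauge (gaugeDir)
open BlockAveragePushDirSplit (flat)
open MinimalActionWitness (flatCfg)
open SmoothRefineBlocks (blk res blk_res_eq_of)
open SmoothRefineInterp (interp interpCore indic cfd wt interp_sub interpCore_insert interpCore_empty interpCore_shift interpCore_const interp_of_res_eq_zero)
open NE3SmoothLiftFlat (sum_sum_ite_lt sum_sum_ite_ge)
open NE3TangentFlatPush (cpush_flatCfg cpush_flatCfg_gaugeDir flatCfg_eq_flat)
open NE7InterpolationLiftFlat (interp_line sum_boxVec_mul_interpCore sum_fin_div_eq sum_fin_one_sub_div_eq)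
open NE7WhitneyLiftFlat (whitneyLift_gaugeDir_flat gaugeDir_flat_apply)

noncomputable section

variable {d : ℕ} {n : Type*} [Fintype n] [DecidableEq n]

/-! ## §1 The binomial stencil and the longitudinal counts -/

section Stencil

variable {X : Type*} [AddCommGroup X] [Module ℝ X]

omit [Fintype n] [DecidableEq n] in
/-- **CONSTANT WEIGHTS**: `interpCore S G z (fun _ ↦ c) = Σ_{T ⊆ S} (c^{|T|}·(1−c)^{|S|−|T|}) • G (z + 𝟙_T)` — the binomial stencil. [folklore] -/
theorem interpCore_const_weights (S : Finset (Fin d)) (G : Site d → X) (z : Site d) (c : ℝ) :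
    interpCore S G z (fun _ => c) = ∑ T ∈ S.powerset, (c ^ T.card * (1 - c) ^ (S.card - T.card)) • G (z + indic T) := by
  unfold interpCore
  refine Finset.sum_congr rfl fun T hT => ?_
  rw [Finset.prod_const, Finset.prod_const, Finset.card_sdiff_of_subset (Finset.mem_powerset.mp hT)]

omit [Fintype n] [DecidableEq n] in
/-- The stencil defect has no zero-order term: `interpCore S G z (const c) − G z = Σ_{T ⊆ S} (c^{|T|}(1−c)^{|S|−|T|}) • (G(z + 𝟙_T) − G z)`. [folklore] -/
theorem interpCore_const_weights_sub_self (S : Finset (Fin d)) (G : Site d → X) (z : Site d) (c : ℝ) :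
    interpCore S G z (fun _ => c) - G z = ∑ T ∈ S.powerset, (c ^ T.card * (1 - c) ^ (S.card - T.card)) • (G (z + indic T) - G z) := by
  have h1 : interpCore S (fun _ => G z) z (fun _ => c) = G z := interpCore_const S (G z) z _
  conv_lhs => rw [← h1]
  rw [interpCore_const_weights, interpCore_const_weights, ← Finset.sum_sub_distrib]
  refine Finset.sum_congr rfl fun T _ => ?_
  rw [← smul_sub]

end Stencil

omit [Fintype n] [DecidableEq n] in
/-- The near longitudinal count: `Σ_{t<M} Σ_{i<M} [t + i < M]·(1∕M) = (M+1)∕2` (`M ≥ 1`). [folklore] -/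
theorem sum_range_indicator_near {M : ℕ} (hM : 1 ≤ M) :
    ∑ t ∈ Finset.range M, ∑ i ∈ Finset.range M, (if t + i < M then ((M : ℝ))⁻¹ else 0) = (((M : ℝ)) + 1) / 2 := by
  have hM0 : (M : ℝ) ≠ 0 := by exact_mod_cast (by omega : M ≠ 0)
  have h := sum_sum_ite_lt M (fun _ => ((M : ℝ))⁻¹)
  rw [h, ← Finset.sum_mul, ← Fin.sum_univ_eq_sum_range (fun t => (t : ℝ) + 1) M]
  have h2 : ∑ t : Fin M, ((t : ℕ) : ℝ) / M = (((M : ℝ)) - 1) / 2 := sum_fin_div_eq hM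
  have h3 : ∑ t : Fin M, (((t : ℕ) : ℝ) + 1) = (∑ t : Fin M, ((t : ℕ) : ℝ) / M) * M + M := by
    rw [Finset.sum_mul, Finset.sum_add_distrib, Finset.sum_const, Finset.card_univ, Fintype.card_fin, nsmul_eq_mul, mul_one]
    congr 1
    exact Finset.sum_congr rfl fun t _ => by field_simp
  rw [h3, h2]
  field_simp
  ring

omit [Fintype n] [DecidableEq n] in
/-- The far longitudinal count: `Σ_{t<M} Σ_{i<M} [t + i ≥ M]·(1∕M) = (M−1)∕2` (`M ≥ 1`). [folklore] -/
theorem sum_range_indicator_far {M : ℕ} (hM : 1 ≤ M) :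
    ∑ t ∈ Finset.range M, ∑ i ∈ Finset.range M, (if t + i < M then 0 else ((M : ℝ))⁻¹) = (((M : ℝ)) - 1) / 2 := by
  have hM0 : (M : ℝ) ≠ 0 := by exact_mod_cast (by omega : M ≠ 0)
  have h := sum_sum_ite_ge M (fun _ => ((M : ℝ))⁻¹)
  rw [h, ← Finset.sum_mul, ← Fin.sum_univ_eq_sum_range (fun t => ((M : ℝ)) - 1 - (t : ℝ)) M]
  have h2 : ∑ t : Fin M, ((t : ℕ) : ℝ) / M = (((M : ℝ)) - 1) / 2 := sum_fin_div_eq hM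
  have h3 : ∑ t : Fin M, (((M : ℝ)) - 1 - ((t : ℕ) : ℝ)) = M * (((M : ℝ)) - 1) - (∑ t : Fin M, ((t : ℕ) : ℝ) / M) * M := by
    rw [Finset.sum_mul, Finset.sum_sub_distrib, Finset.sum_const, Finset.card_univ, Fintype.card_fin, nsmul_eq_mul]
    congr 1
    exact Finset.sum_congr rfl fun t _ => by field_simp
  rw [h3, h2]
  field_simp
  ring

/-! ## §2 The straight-line block average of the lift is the binomial smoothing of the datum -/

/-- **`linQ_M (Wφ) (M•y) κ = interpCore univ (φ(·,κ)) y (const (M−1)∕(2M))`** (`M ≥ 1`): the straight-line block average of the Whitney-type lift is the `d`-dimensional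
binomial smoothing stencil with weight `(M−1)∕(2M)` per direction (and `(M+1)∕(2M)` on the complement) — symmetric in ALL `d` directions, reproducing constants. [folklore] -/
theorem linQ_whitneyLift {M : ℕ} (hM : 1 ≤ M) (φ : Site d → Fin d → Matrix n n ℂ) (y : Site d) (κ : Fin d) :
    linQ M (fun z κ' => ((M : ℝ)⁻¹) • interp M (Finset.univ.erase κ') (fun w => φ w κ') z) ((M : ℤ) • y) κ
      = interpCore Finset.univ (fun w => φ w κ) y (fun _ => (((M : ℝ)) - 1) / (2 * M)) := by
  have hM0 : (M : ℝ) ≠ 0 := by exact_mod_cast (by omega : M ≠ 0)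
  set S : Finset (Fin d) := Finset.univ.erase κ with hS
  have hκS : κ ∉ S := by simp [hS]
  set G : Site d → Matrix n n ℂ := fun w => φ w κ with hG
  -- the near and far longitudinal weights of a start offset `r_κ`
  let A : ℕ → ℝ := fun ρ => ∑ i ∈ Finset.range M, (if ρ + i < M then ((M : ℝ))⁻¹ else 0)
  let B : ℕ → ℝ := fun ρ => ∑ i ∈ Finset.range M, (if ρ + i < M then 0 else ((M : ℝ))⁻¹)
  -- (1) each line
  have hline : ∀ r : Fin d → Fin M, ∑ i : Fin M,
      (fun z κ' => ((M : ℝ)⁻¹) • interp M (Finset.univ.erase κ') (fun w => φ w κ') z) ((M : ℤ) • y + boxVec M r + ((i : ℕ) : ℤ) • e κ) κ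
      = A (r κ) • interpCore S G y (fun j => ((r j : ℕ) : ℝ) / M) + B (r κ) • interpCore S G (y + e κ) (fun j => ((r j : ℕ) : ℝ) / M) := by
    intro r
    have hsum : ∀ i : Fin M,
        (fun z κ' => ((M : ℝ)⁻¹) • interp M (Finset.univ.erase κ') (fun w => φ w κ') z) ((M : ℤ) • y + boxVec M r + ((i : ℕ) : ℤ) • e κ) κ
        = (if (r κ : ℕ) + i < M then ((M : ℝ))⁻¹ else 0) • interpCore S G y (fun j => ((r j : ℕ) : ℝ) / M)
          + (if (r κ : ℕ) + i < M then 0 else ((M : ℝ))⁻¹) • interpCore S G (y + e κ) (fun j => ((r j : ℕ) : ℝ) / M) := by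
      intro i
      show ((M : ℝ)⁻¹) • interp M S G ((M : ℤ) • y + boxVec M r + ((i : ℕ) : ℤ) • e κ) = _
      rw [interp_line hM hκS G y r i.isLt]
      by_cases h : (r κ : ℕ) + i < M
      · rw [if_pos h, if_pos h, if_pos h, zero_smul, add_zero]
      · rw [if_neg h, if_neg h, if_neg h, zero_smul, zero_add]
    rw [Finset.sum_congr rfl fun i _ => hsum i, Finset.sum_add_distrib, ← Finset.sum_smul, ← Finset.sum_smul]
    simp only [A, B, Fin.sum_univ_eq_sum_range (fun i => if (r κ : ℕ) + i < M then ((M : ℝ))⁻¹ else 0) M,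
      Fin.sum_univ_eq_sum_range (fun i => if (r κ : ℕ) + i < M then (0 : ℝ) else ((M : ℝ))⁻¹) M]
  -- (2) the longitudinal sums
  have hA : ∑ t : Fin M, A t = (((M : ℝ)) + 1) / 2 := by
    rw [Fin.sum_univ_eq_sum_range (fun t => A t) M]
    exact sum_range_indicator_near hM
  have hB : ∑ t : Fin M, B t = (((M : ℝ)) - 1) / 2 := by
    rw [Fin.sum_univ_eq_sum_range (fun t => B t) M]
    exact sum_range_indicator_far hM
  -- (3) the transverse block sums are binomial stencils of `S`
  have hScard : S.card = d - 1 := by rw [hS, Finset.card_erase_of_mem (Finset.mem_univ κ), Finset.card_univ, Fintype.card_fin]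
  have hd : 1 ≤ d := Nat.one_le_iff_ne_zero.mpr (by rintro rfl; exact Fin.elim0 κ)
  have hstencil : ∀ z : Site d, ∑ T ∈ S.powerset, (((((M : ℝ)) - 1) / 2) ^ T.card * ((((M : ℝ)) + 1) / 2) ^ (S.card - T.card)) • G (z + indic T)
      = ((M : ℝ) ^ (d - 1)) • interpCore S G z (fun _ => (((M : ℝ)) - 1) / (2 * M)) := by
    intro z
    rw [interpCore_const_weights, Finset.smul_sum]
    refine Finset.sum_congr rfl fun T hT => ?_
    rw [smul_smul]
    congr 1
    have hTS : T.card ≤ S.card := Finset.card_le_card (Finset.mem_powerset.mp hT)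
    rw [hScard] at hTS ⊢
    have e1 : 1 - (((M : ℝ)) - 1) / (2 * M) = ((((M : ℝ)) + 1) / 2) / M := by field_simp; ring
    have e2 : (((M : ℝ)) - 1) / (2 * M) = ((((M : ℝ)) - 1) / 2) / M := by field_simp
    rw [e1, e2]
    obtain ⟨k, hk⟩ : ∃ k, d - 1 = T.card + k := ⟨d - 1 - T.card, by omega⟩
    rw [hk, Nat.add_sub_cancel_left, pow_add, div_pow _ (M : ℝ), div_pow _ (M : ℝ)]
    field_simp
  -- (4) assemble
  rw [linQ_eq_sum]
  calc ∑ r : Fin d → Fin M, (((M : ℝ) ^ d)⁻¹ : ℝ) • ∑ i : Fin M,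
        (fun z κ' => ((M : ℝ)⁻¹) • interp M (Finset.univ.erase κ') (fun w => φ w κ') z) ((M : ℤ) • y + boxVec M r + ((i : ℕ) : ℤ) • e κ) κ
      = (((M : ℝ) ^ d)⁻¹ : ℝ) • ((∑ r : Fin d → Fin M, A (r κ) • interpCore S G y (fun j => ((r j : ℕ) : ℝ) / M))
          + ∑ r : Fin d → Fin M, B (r κ) • interpCore S G (y + e κ) (fun j => ((r j : ℕ) : ℝ) / M)) := by
        rw [← Finset.smul_sum, Finset.sum_congr rfl fun r _ => hline r, Finset.sum_add_distrib]
    _ = (((M : ℝ) ^ d)⁻¹ : ℝ) • ((∑ T ∈ S.powerset, ((∑ t : Fin M, A t) * ((((M : ℝ)) - 1) / 2) ^ T.card * ((((M : ℝ)) + 1) / 2) ^ (S.card - T.card)) • G (y + indic T))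
          + ∑ T ∈ S.powerset, ((∑ t : Fin M, B t) * ((((M : ℝ)) - 1) / 2) ^ T.card * ((((M : ℝ)) + 1) / 2) ^ (S.card - T.card)) • G (y + e κ + indic T)) := by
        rw [hS, sum_boxVec_mul_interpCore hM κ (fun t => A t) G y, sum_boxVec_mul_interpCore hM κ (fun t => B t) G (y + e κ)]
    _ = (((M : ℝ) ^ d)⁻¹ : ℝ) • (((((M : ℝ)) + 1) / 2) • (((M : ℝ) ^ (d - 1)) • interpCore S G y (fun _ => (((M : ℝ)) - 1) / (2 * M)))
          + ((((M : ℝ)) - 1) / 2) • (((M : ℝ) ^ (d - 1)) • interpCore S G (y + e κ) (fun _ => (((M : ℝ)) - 1) / (2 * M)))) := by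
        rw [hA, hB, ← hstencil y, ← hstencil (y + e κ), Finset.smul_sum, Finset.smul_sum]
        congr 1
        congr 1
        all_goals
          refine Finset.sum_congr rfl fun T _ => ?_
          rw [smul_smul]
          congr 1
          ring
    _ = interpCore Finset.univ G y (fun _ => (((M : ℝ)) - 1) / (2 * M)) := by
        rw [← Finset.insert_erase (Finset.mem_univ κ), ← hS, interpCore_insert hκS, interpCore_shift]
        have hd1 : (M : ℝ) ^ d = (M : ℝ) ^ (d - 1) * M := by
          obtain ⟨k, rfl⟩ : ∃ k, d = k + 1 := ⟨d - 1, by omega⟩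
          rw [Nat.add_sub_cancel, pow_succ]
        rw [hd1, smul_add, smul_smul, smul_smul, smul_smul, smul_smul]
        congr 1
        all_goals
          congr 1
          field_simp
        ring

/-! ## §3 The full one-step linearised average of the lift -/

/-- **`cpush M 1 (Wφ) y κ = (F̂(Wφ)(M•y) − F̂(Wφ)(M•y + M•e_κ)) + interpCore univ (φ(·,κ)) y (const (M−1)∕(2M))`** (`M ≥ 1`): the full flat linearised average of the lift is
the coarse gauge direction of the lift's frames plus the binomial stencil (✓ `NE3TangentFlatPush.cpush_flatCfg` + `linQ_whitneyLift`). [folklore] -/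
theorem cpush_flatCfg_whitneyLift {M : ℕ} (hM : 1 ≤ M) (φ : Site d → Fin d → Matrix n n ℂ) (y : Site d) (κ : Fin d) :
    cpush M (flatCfg (d := d) (n := n)) (fun z κ' => ((M : ℝ)⁻¹) • interp M (Finset.univ.erase κ') (fun w => φ w κ') z) y κ
      = (Fhat M (fun z κ' => ((M : ℝ)⁻¹) • interp M (Finset.univ.erase κ') (fun w => φ w κ') z) ((M : ℤ) • y)
          - Fhat M (fun z κ' => ((M : ℝ)⁻¹) • interp M (Finset.univ.erase κ') (fun w => φ w κ') z) ((M : ℤ) • y + (M : ℤ) • e κ))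
        + interpCore Finset.univ (fun w => φ w κ) y (fun _ => (((M : ℝ)) - 1) / (2 * M)) := by
  rw [cpush_flatCfg M hM, linQ_whitneyLift hM]

/-! ## §4 Gauge directions are reproduced exactly; the defect annihilates the gauge sector -/

section Gauge

variable {X : Type*} [AddCommGroup X] [Module ℝ X]

omit [Fintype n] [DecidableEq n] in
/-- The nodal interpolant reproduces the nodes: `interp M univ ν (M•y) = ν y` (`M ≥ 1`). [folklore] -/
theorem interp_smul_site {M : ℕ} (hM : 1 ≤ M) (S : Finset (Fin d)) (ν : Site d → X) (y : Site d) :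
    interp M S ν ((M : ℤ) • y) = ν y := by
  have hbr := blk_res_eq_of (L := M) hM (y := (M : ℤ) • y) (z := y) (ρ := 0) (by simp) (fun _ => le_rfl)
    (fun _ => by simp only [Pi.zero_apply]; exact_mod_cast (by omega : 0 < M))
  rw [interp_of_res_eq_zero M S ν _ (fun i _ => by rw [hbr.2]; rfl), hbr.1]

end Gauge

/-- **THE LIFT IS AN EXACT RIGHT INVERSE ON THE GAUGE SECTOR** (`M ≥ 1`): `cpush M 1 (W (gaugeDir 1 ν)) = gaugeDir 1 ν` for every coarse site field `ν` — W1a's gauge commutation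
`W (gaugeDir 1 ν) = gaugeDir 1 (interp M univ ν)`, the exact covariance ✓ `cpush_flatCfg_gaugeDir`, and the nodes of the nodal interpolant. [folklore] -/
theorem cpush_flatCfg_whitneyLift_gaugeDir {M : ℕ} (hM : 1 ≤ M) (ν : Site d → Matrix n n ℂ) :
    cpush M (flatCfg (d := d) (n := n)) (fun z κ' => ((M : ℝ)⁻¹) • interp M (Finset.univ.erase κ') (fun w => gaugeDir (flatCfg (d := d) (n := n)) ν w κ') z)
      = gaugeDir (flatCfg (d := d) (n := n)) ν := by
  have hW : (fun z κ' => ((M : ℝ)⁻¹) • interp M (Finset.univ.erase κ') (fun w => gaugeDir (flatCfg (d := d) (n := n)) ν w κ') z)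
      = gaugeDir (flatCfg (d := d) (n := n)) (interp M Finset.univ ν) := by
    funext z κ'
    rw [flatCfg_eq_flat]
    exact whitneyLift_gaugeDir_flat hM ν z κ'
  rw [hW, cpush_flatCfg_gaugeDir M hM]
  funext y κ
  simp only [interp_smul_site hM]

/-- **THE DEFECT OF THE LIFT ANNIHILATES THE GAUGE SECTOR**: `cpush M 1 (W (gaugeDir 1 ν)) − gaugeDir 1 ν = 0`. [folklore] -/
theorem whitneyDefect_gaugeDir {M : ℕ} (hM : 1 ≤ M) (ν : Site d → Matrix n n ℂ) (y : Site d) (κ : Fin d) :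
    cpush M (flatCfg (d := d) (n := n)) (fun z κ' => ((M : ℝ)⁻¹) • interp M (Finset.univ.erase κ') (fun w => gaugeDir (flatCfg (d := d) (n := n)) ν w κ') z) y κ
      - gaugeDir (flatCfg (d := d) (n := n)) ν y κ = 0 := by
  rw [cpush_flatCfg_whitneyLift_gaugeDir hM, sub_self]

end

end Summit.QuantumFields.BalabanUV.T4Continuum.NE7WhitneyLiftAverage
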